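import Summits.Ventures.HSemireg.ContractionSpanAlgebra
import Mathlib.RingTheory.Nilpotent.Basic
import Mathlib.Algebra.BigOperators.Ring.Finset
import Mathlib.Algebra.Group.Commute.Units
import HarnessLib

/-!
# Venture HSemireg — twisting by a line bundle does not change the polyvector contraction rank
# (the class-level conjugation lemma `r(E ⊗ M) = r(E)`, all dimensions, kernel proof)

HONEST FRAMING. Pure linear algebra in the exterior algebra `Λ V`, written for the computation cell
`pub-hsemireg` (seat p6, «`⊗ M` / Mukai-transform facts used by the amplification chain») over seat p4's
abstract contraction span `ContractionSpan.span L Θ x` (`ContractionSpanAlgebra.lean`). Nothing here is a claim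
about any variety; nothing here says that HC / HC_CM / HC_AV holds. Everything is PROVED; no named fact, no
new definition.

THE STEP SERVED. The cell's census certificate (I2-β) «`r(𝓔) = 18 = dim Ext²(𝓔, 𝓔)`» for the fourfold object
`𝓔 = E₀ ⊗ M_B` (`theory/TH2-ASSEMBLY-NOTE-2PAGE.md` §0) is stated in the polyvector contraction rank
`r(F) = rank(ξ ↦ ξ ⌟ ch F)` (`contractionRank`, `PerfectComplexRankDoor.lean`; by [BuchweitzFlenner2008HH]
Prop. 6.4.4 `σ_F ∘ c_F = ⌟ ch F`, so `dim Ext² ≤ r` forces full semiregularity, ON PAPER). Its (I2-β′) is the CLASS-LEVEL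
CONJUGATION LEMMA «`r(E ⊗ M) = r(E)`», so far a seat lemma checked numerically as an operator identity in
`dim W = 2, 3` (th-2; referee `ref/NOTE-CONJ-LEMMA-1.md`; red team RED-1 V8-T3). This file PROVES it for every
abelian variety of every dimension, in the tree's own currency:
* §1 `commute_of_mem_span_ι_mul_ι`, `isNilpotent_of_mem_span_ι_mul_ι`, `contractLeft_mul_of_mem_span_ι_mul_ι`:
  classes `c ∈ span{v ∧ w}` are central and nilpotent, and `ι_θ` (Mathlib's `CliffordAlgebra.contractLeft`)
  is a derivation across them; `contractLeft_mem_span_image_of_mem_twist`: for `θ` killing `L` («vector fields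
  kill `H^{0,1}`») and `c ∈ span{v ∧ q : q ∈ L}` («type `(1,1) ⊕ (0,2)`», e.g. `c₁(M)`), `β_θ := ι_θ c ∈ span L`
  (a `(2,0)`-part of `c` would instead produce `(1,0)`-wedges and scalars — the referee's clause);
* §3 ENGINE `span_mul_eq_map` / `rank_span_mul_eq` (characteristic-free): for a central unit `u` with
  `ι_θ(u ∧ z) = u ∧ (ι_θ z + β_θ ∧ z)`, `β_θ ∈ span L`, the contraction span of `u ∧ x` is `u ∧ (span of x)` —
  the unipotent substitution `T_c` — hence of the same rank;
* §4 `contractLeft_expSum_mul`: THE PRINTED IDENTITY `ι_θ(e^{c} ∧ z) = e^{c} ∧ (ι_θ z + (ι_θ c) ∧ z)`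
  (`e^{-c} ι_θ e^{c} = ι_θ + β_θ ∧`) for `e^{c} = Σ_{k<N} cᵏ/k!`, `c^N = 0`; `rank_span_mul_expSum_eq`:
  `rank span(x ∧ e^{c}) = rank span(x)`; `rank_span_mul_one_add_smul_eq`: the elementary twist (non-vacuity);
* §5 BRIDGE `contractionRank_eq_of_totalExteriorClass_eq_mul_expSum`: on an abelian variety `A/ℂ`, if
  `Σ_p κ'_p = (Σ_p κ_p) · e^{c}` in `Λ H¹(A(ℂ); ℂ)` with `c ∈ span{v ∧ q : q ∈ H^{0,1}}`, then
  `contractionRank A κ' = contractionRank A κ`; `le_lift_contractionRank_of_twist` transports the census-row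
  binder «`rank Ext² ≤ r`» of the cell's g = 4 theorem (seat p7, `AmplificationChainG4RouteC.lean` §5).
BY VALUE (not in the kernel): `ch(E ⊗ M) = ch(E)·e^{c₁(M)}` (the tree's `ChernCharacterBetti` has no `⊗`; [Fulton1998]
§15.1 (i) `ch` a ring homomorphism, (iii) `ch(L) = e^{c₁(L)}`) and «`c₁(M)` is of type `(1,1)`» ([LangeBirkenhake1992] §2.1). Companions: `Ext` side = p6's
`DerivedEquivalenceExtRank.lean`; full-`σ` side = th-4's `UntwistFullSigma.lean`. References: [BourbakiAlgebre1a3]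
Ch. III §7, §11 no. 9 (even elements central; interior products are antiderivations); [BuchweitzFlenner2008HH]
Prop. 6.4.4; [BuchweitzFlenner2003] Prop. 3.12 (centrality of `At` of a line bundle: origin of the twist formula).
-/

noncomputable section

open CliffordAlgebra (contractLeft)
open ExteriorAlgebra (ι)
open Literature.AlgebraicGeometry.Motives Literature.AlgebraicGeometry.HodgeTheory

namespace Summit.Ventures.HSemireg

namespace ContractionSpan

section Ring
variable {K : Type*} [CommRing K] {V : Type*} [AddCommGroup V] [Module K V]

/-! ### 1. Degree-two decomposables: central, nilpotent, Leibniz rule for `ι_θ` -/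

/-- `v ∧ w` is central in `Λ V` (even elements commute with everything).
[cite: BourbakiAlgebre1a3, Ch. III §7] -/
theorem commute_ι_mul_ι (v w : V) (z : ExteriorAlgebra K V) : Commute (ι K v * ι K w) z := by
  induction z using ExteriorAlgebra.induction with
  | algebraMap r => exact (Algebra.commutes r _).symm
  | ι m =>
    have h1 : ι K w * ι K m = -(ι K m * ι K w) := eq_neg_of_add_eq_zero_left (ExteriorAlgebra.ι_add_mul_swap w m)
    have h2 : ι K v * ι K m = -(ι K m * ι K v) := eq_neg_of_add_eq_zero_left (ExteriorAlgebra.ι_add_mul_swap v m)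
    show ι K v * ι K w * ι K m = ι K m * (ι K v * ι K w)
    rw [mul_assoc, h1, mul_neg, ← mul_assoc, h2, neg_mul, neg_neg, mul_assoc]
  | mul a b ha hb => exact ha.mul_right hb
  | add a b ha hb => exact ha.add_right hb

/-- Every element of `span{v ∧ w}` is central in `Λ V`. [cite: BourbakiAlgebre1a3, Ch. III §7] -/
theorem commute_of_mem_span_ι_mul_ι {c : ExteriorAlgebra K V}
    (hc : c ∈ Submodule.span K {z : ExteriorAlgebra K V | ∃ v w : V, z = ι K v * ι K w}) (z : ExteriorAlgebra K V) :
    Commute c z := by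
  induction hc using Submodule.span_induction with
  | mem x hx => obtain ⟨v, w, rfl⟩ := hx; exact commute_ι_mul_ι v w z
  | zero => exact Commute.zero_left z
  | add x y _ _ hx hy => exact hx.add_left hy
  | smul r x _ hx => exact hx.smul_left r

/-- `(v ∧ w)² = 0`. [cite: BourbakiAlgebre1a3, Ch. III §7] -/
theorem ι_mul_ι_sq_eq_zero (v w : V) : (ι K v * ι K w) ^ 2 = 0 := by
  have h1 : ι K w * ι K v = -(ι K v * ι K w) := eq_neg_of_add_eq_zero_left (ExteriorAlgebra.ι_add_mul_swap w v)
  calc (ι K v * ι K w) ^ 2 = ι K v * (ι K w * ι K v) * ι K w := by rw [pow_two]; simp only [mul_assoc]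
    _ = -(ι K v * ι K v * (ι K w * ι K w)) := by rw [h1]; simp only [mul_neg, neg_mul, mul_assoc]
    _ = 0 := by rw [ExteriorAlgebra.ι_sq_zero, zero_mul, neg_zero]

/-- Every element of `span{v ∧ w}` is NILPOTENT (a commuting sum of square-zero elements), so `e^{c}` is the
finite sum `Σ_{k<N} cᵏ/k!` for any `N` past the nilpotency order. [cite: BourbakiAlgebre1a3, Ch. III §7] -/
theorem isNilpotent_of_mem_span_ι_mul_ι {c : ExteriorAlgebra K V}
    (hc : c ∈ Submodule.span K {z : ExteriorAlgebra K V | ∃ v w : V, z = ι K v * ι K w}) : IsNilpotent c := by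
  induction hc using Submodule.span_induction with
  | mem x hx => obtain ⟨v, w, rfl⟩ := hx; exact ⟨2, ι_mul_ι_sq_eq_zero v w⟩
  | zero => exact IsNilpotent.zero
  | add x y hx' _ hx hy => exact Commute.isNilpotent_add (commute_of_mem_span_ι_mul_ι hx' y) hx hy
  | smul r x _ hx => exact hx.smul r

/-- **`ι_θ` is a derivation across even decomposables**: `ι_θ (c ∧ z) = (ι_θ c) ∧ z + c ∧ ι_θ z` for
`c ∈ span{v ∧ w}` (the antiderivation sign `(-1)^{deg c}` is `+1`). [cite: BourbakiAlgebre1a3, Ch. III §11 no. 9] -/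
theorem contractLeft_mul_of_mem_span_ι_mul_ι (θ : Module.Dual K V) {c : ExteriorAlgebra K V}
    (hc : c ∈ Submodule.span K {z : ExteriorAlgebra K V | ∃ v w : V, z = ι K v * ι K w}) (z : ExteriorAlgebra K V) :
    contractLeft θ (c * z) = contractLeft θ c * z + c * contractLeft θ z := by
  induction hc using Submodule.span_induction with
  | mem x hx =>
    obtain ⟨v, w, rfl⟩ := hx
    have hD2 : contractLeft θ (ι K v * ι K w) = θ v • ι K w - θ w • ι K v := by
      rw [CliffordAlgebra.contractLeft_ι_mul, CliffordAlgebra.contractLeft_ι, ← Algebra.commutes, ← Algebra.smul_def]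
    rw [hD2, mul_assoc (ι K v) (ι K w) z, CliffordAlgebra.contractLeft_ι_mul, CliffordAlgebra.contractLeft_ι_mul,
      mul_sub, mul_smul_comm, sub_mul, smul_mul_assoc, smul_mul_assoc, mul_assoc (ι K v) (ι K w)]
    abel
  | zero => simp only [zero_mul, map_zero, zero_add]
  | add x y _ _ hx hy => rw [add_mul, map_add, map_add, hx, hy, add_mul, add_mul]; abel
  | smul r x _ hx => rw [smul_mul_assoc, map_smul, map_smul, hx, smul_add, smul_mul_assoc, smul_mul_assoc]

/-- Powers: `ι_θ (cᵏ⁺¹ ∧ z) = cᵏ⁺¹ ∧ ι_θ z + (k+1) · cᵏ ∧ (ι_θ c) ∧ z` for `c ∈ span{v ∧ w}`.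
[cite: BourbakiAlgebre1a3, Ch. III §11 no. 9] -/
theorem contractLeft_pow_succ_mul (θ : Module.Dual K V) {c : ExteriorAlgebra K V}
    (hc : c ∈ Submodule.span K {z : ExteriorAlgebra K V | ∃ v w : V, z = ι K v * ι K w}) (k : ℕ)
    (z : ExteriorAlgebra K V) :
    contractLeft θ (c ^ (k + 1) * z) = c ^ (k + 1) * contractLeft θ z + (k + 1) • (c ^ k * (contractLeft θ c * z)) := by
  induction k generalizing z with
  | zero => rw [zero_add, pow_one, pow_zero, one_smul, one_mul, contractLeft_mul_of_mem_span_ι_mul_ι θ hc, add_comm]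
  | succ k ih =>
    have hcomm : contractLeft θ c * c ^ (k + 1) = c ^ (k + 1) * contractLeft θ c :=
      ((commute_of_mem_span_ι_mul_ι hc (contractLeft θ c)).pow_left (k + 1)).eq.symm
    rw [show c ^ (k + 1 + 1) * z = c * (c ^ (k + 1) * z) by rw [pow_succ', mul_assoc],
      contractLeft_mul_of_mem_span_ι_mul_ι θ hc, ih, mul_add, ← mul_assoc c (c ^ (k + 1)), ← pow_succ',
      mul_smul_comm, ← mul_assoc c (c ^ k), ← pow_succ', ← mul_assoc (contractLeft θ c) (c ^ (k + 1)) z, hcomm,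
      mul_assoc (c ^ (k + 1)) (contractLeft θ c) z, succ_nsmul _ (k + 1)]
    abel

/-- **`ι_θ c ∈ span L`** when `θ` kills `L` and `c ∈ span{v ∧ q : q ∈ L}`, since `ι_θ(v ∧ q) = θ(v) q - θ(q) v`
(«`β_θ = ι_θ c₁(M) ∈ H^{0,1}` for `c₁(M)` of type `(1,1)`, `θ` a vector field»). [cite: BourbakiAlgebre1a3, Ch. III §11 no. 9] -/
theorem contractLeft_mem_span_image_of_mem_twist {L : Set V} {θ : Module.Dual K V} (hθ : ∀ q ∈ L, θ q = 0)
    {c : ExteriorAlgebra K V}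
    (hc : c ∈ Submodule.span K {z : ExteriorAlgebra K V | ∃ v : V, ∃ q ∈ L, z = ι K v * ι K q}) :
    contractLeft θ c ∈ Submodule.span K (ι K '' L) := by
  induction hc using Submodule.span_induction with
  | mem x hx =>
    obtain ⟨v, q, hq, rfl⟩ := hx
    rw [CliffordAlgebra.contractLeft_ι_mul, CliffordAlgebra.contractLeft_ι, hθ q hq, map_zero, mul_zero, sub_zero]
    exact Submodule.smul_mem _ _ (Submodule.subset_span ⟨q, hq, rfl⟩)
  | zero => rw [map_zero]; exact Submodule.zero_mem _
  | add x y _ _ hx hy => rw [map_add]; exact Submodule.add_mem _ hx hy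
  | smul r x _ hx => rw [map_smul]; exact Submodule.smul_mem _ r hx

/-- The twist classes `span{v ∧ q : q ∈ L}` lie in the even decomposable span `span{v ∧ w}`. [folklore] -/
theorem span_twist_le (L : Set V) :
    Submodule.span K {z : ExteriorAlgebra K V | ∃ v : V, ∃ q ∈ L, z = ι K v * ι K q} ≤
      Submodule.span K {z : ExteriorAlgebra K V | ∃ v w : V, z = ι K v * ι K w} :=
  Submodule.span_mono fun _ ⟨v, q, _, h⟩ => ⟨v, q, h⟩

/-! ### 2. Bookkeeping inside the contraction span for wedges with `β ∈ span L` -/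

/-- `ι_θ (β ∧ y) = -β ∧ ι_θ y` for `β ∈ span L` and `θ` killing `L`. [cite: BourbakiAlgebre1a3, Ch. III §11 no. 9] -/
theorem contractLeft_mul_of_mem_span_image {L : Set V} {θ : Module.Dual K V} (hθ : ∀ q ∈ L, θ q = 0)
    {β : ExteriorAlgebra K V} (hβ : β ∈ Submodule.span K (ι K '' L)) (y : ExteriorAlgebra K V) :
    contractLeft θ (β * y) = -(β * contractLeft θ y) := by
  induction hβ using Submodule.span_induction with
  | mem x hx => obtain ⟨q, hq, rfl⟩ := hx; rw [CliffordAlgebra.contractLeft_ι_mul, hθ q hq, zero_smul, zero_sub]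
  | zero => rw [zero_mul, map_zero, zero_mul, neg_zero]
  | add x x' _ _ hx hx' => rw [add_mul, map_add, hx, hx', add_mul, neg_add]
  | smul r x _ hx => rw [smul_mul_assoc, map_smul, hx, smul_mul_assoc, smul_neg]

/-- `q ∧ β ∧ y ∈ span L Θ y` for `q ∈ L`, `β ∈ span L` (`Λ²`-wedge generators). [cite: BourbakiAlgebre1a3, Ch. III §7] -/
theorem ι_mul_mul_mem_span {L : Set V} (Θ : Set (Module.Dual K V)) {q : V} (hq : q ∈ L)
    {β : ExteriorAlgebra K V} (hβ : β ∈ Submodule.span K (ι K '' L)) (y : ExteriorAlgebra K V) :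
    ι K q * (β * y) ∈ span L Θ y := by
  induction hβ using Submodule.span_induction with
  | mem x hx => obtain ⟨q₂, hq₂, rfl⟩ := hx; exact Submodule.subset_span (Or.inl (Or.inl ⟨q, hq, q₂, hq₂, rfl⟩))
  | zero => rw [zero_mul, mul_zero]; exact Submodule.zero_mem _
  | add x x' _ _ hx hx' => rw [add_mul, mul_add]; exact Submodule.add_mem _ hx hx'
  | smul r x _ hx => rw [smul_mul_assoc, mul_smul_comm]; exact Submodule.smul_mem _ r hx

/-- `β ∧ ι_θ y ∈ span L Θ y` for `β ∈ span L`, `θ ∈ Θ` (mixed generators). [cite: BourbakiAlgebre1a3, Ch. III §11 no. 9] -/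
theorem mul_contractLeft_mem_span {L : Set V} {Θ : Set (Module.Dual K V)} {θ : Module.Dual K V} (hθ : θ ∈ Θ)
    {β : ExteriorAlgebra K V} (hβ : β ∈ Submodule.span K (ι K '' L)) (y : ExteriorAlgebra K V) :
    β * contractLeft θ y ∈ span L Θ y := by
  induction hβ using Submodule.span_induction with
  | mem x hx => obtain ⟨q, hq, rfl⟩ := hx; exact Submodule.subset_span (Or.inl (Or.inr ⟨q, hq, θ, hθ, rfl⟩))
  | zero => rw [zero_mul]; exact Submodule.zero_mem _
  | add x x' _ _ hx hx' => rw [add_mul]; exact Submodule.add_mem _ hx hx'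
  | smul r x _ hx => rw [smul_mul_assoc]; exact Submodule.smul_mem _ r hx

/-- `β₁ ∧ β₂ ∧ y ∈ span L Θ y` for `β₁, β₂ ∈ span L`. [cite: BourbakiAlgebre1a3, Ch. III §7] -/
theorem mul_mul_mem_span {L : Set V} (Θ : Set (Module.Dual K V)) {β₁ β₂ : ExteriorAlgebra K V}
    (hβ₁ : β₁ ∈ Submodule.span K (ι K '' L)) (hβ₂ : β₂ ∈ Submodule.span K (ι K '' L)) (y : ExteriorAlgebra K V) :
    β₁ * (β₂ * y) ∈ span L Θ y := by
  induction hβ₁ using Submodule.span_induction with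
  | mem x hx => obtain ⟨q, hq, rfl⟩ := hx; exact ι_mul_mul_mem_span Θ hq hβ₂ y
  | zero => rw [zero_mul]; exact Submodule.zero_mem _
  | add x x' _ _ hx hx' => rw [add_mul]; exact Submodule.add_mem _ hx hx'
  | smul r x _ hx => rw [smul_mul_assoc]; exact Submodule.smul_mem _ r hx

/-! ### 3. ENGINE: a central unit with a unipotent conjugation rule on the `ι_θ` -/

/-- **One inclusion, for any central `u`** (no invertibility): if `Θ` kills `L` and every `θ ∈ Θ` has a
`β_θ ∈ span L` with `ι_θ(u ∧ z) = u ∧ (ι_θ z + β_θ ∧ z)`, then `span L Θ (u ∧ x) ≤ u ∧ span L Θ x` — the unipotent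
substitution `T_c(q₁∧q₂∧) = q₁∧q₂∧`, `T_c(q ∧ ι_θ) = q ∧ ι_θ + q ∧ β_θ ∧`,
`T_c(ι_{θ₁} ι_{θ₂}) = ι_{θ₁} ι_{θ₂} - β_{θ₂} ∧ ι_{θ₁} + β_{θ₁} ∧ ι_{θ₂} + β_{θ₁} ∧ β_{θ₂} ∧` on the three generator families.
[cite: BourbakiAlgebre1a3, Ch. III §11 no. 9] [cite: BuchweitzFlenner2008HH, Prop. 6.4.4] -/
theorem span_mul_le_map {L : Set V} {Θ : Set (Module.Dual K V)} (hΘL : ∀ θ ∈ Θ, ∀ q ∈ L, θ q = 0)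
    {u : ExteriorAlgebra K V} (hu : ∀ z, Commute u z)
    (hD : ∀ θ ∈ Θ, ∃ β ∈ Submodule.span K (ι K '' L), ∀ z : ExteriorAlgebra K V,
      contractLeft θ (u * z) = u * (contractLeft θ z + β * z))
    (x : ExteriorAlgebra K V) :
    span L Θ (u * x) ≤ (span L Θ x).map (LinearMap.mulLeft K u) := by
  have hc : ∀ a b : ExteriorAlgebra K V, a * (u * b) = u * (a * b) := fun a b => by
    rw [← mul_assoc, ← (hu a).eq, mul_assoc]
  refine Submodule.span_le.mpr ?_
  rintro y ((⟨q₁, hq₁, q₂, hq₂, rfl⟩ | ⟨q, hq, θ, hθ, rfl⟩) | ⟨θ₁, hθ₁, θ₂, hθ₂, rfl⟩)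
  · refine ⟨ι K q₁ * (ι K q₂ * x), Submodule.subset_span (Or.inl (Or.inl ⟨q₁, hq₁, q₂, hq₂, rfl⟩)), ?_⟩
    rw [LinearMap.mulLeft_apply, hc, hc]
  · obtain ⟨β, hβ, hβD⟩ := hD θ hθ
    refine ⟨ι K q * contractLeft θ x + ι K q * (β * x),
      Submodule.add_mem _ (Submodule.subset_span (Or.inl (Or.inr ⟨q, hq, θ, hθ, rfl⟩)))
        (ι_mul_mul_mem_span Θ hq hβ x), ?_⟩
    rw [LinearMap.mulLeft_apply, hβD, hc, mul_add (ι K q)]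
  · obtain ⟨β₁, hβ₁, hβD₁⟩ := hD θ₁ hθ₁
    obtain ⟨β₂, hβ₂, hβD₂⟩ := hD θ₂ hθ₂
    refine ⟨contractLeft θ₁ (contractLeft θ₂ x) + -(β₂ * contractLeft θ₁ x) + β₁ * contractLeft θ₂ x +
        β₁ * (β₂ * x), ?_, ?_⟩
    · exact Submodule.add_mem _ (Submodule.add_mem _ (Submodule.add_mem _
        (Submodule.subset_span (Or.inr ⟨θ₁, hθ₁, θ₂, hθ₂, rfl⟩))
        (Submodule.neg_mem _ (mul_contractLeft_mem_span hθ₁ hβ₂ x))) (mul_contractLeft_mem_span hθ₂ hβ₁ x))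
        (mul_mul_mem_span Θ hβ₁ hβ₂ x)
    · rw [LinearMap.mulLeft_apply, hβD₂, hβD₁, map_add, contractLeft_mul_of_mem_span_image (hΘL θ₁ hθ₁) hβ₂]
      simp only [mul_add, add_assoc]

/-- **ENGINE — the contraction span of `u ∧ x` is `u ∧ (the contraction span of x)`** for a central UNIT `u` with
the unipotent conjugation rule `ι_θ(u ∧ z) = u ∧ (ι_θ z + β_θ ∧ z)`, `β_θ ∈ span L` (`θ ∈ Θ`, `Θ` killing `L`); the
reverse inclusion is the forward one for `u⁻¹` (rule with `-β_θ`). [cite: BuchweitzFlenner2008HH, Prop. 6.4.4] -/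
theorem span_mul_eq_map {L : Set V} {Θ : Set (Module.Dual K V)} (hΘL : ∀ θ ∈ Θ, ∀ q ∈ L, θ q = 0)
    {u : ExteriorAlgebra K V} (hunit : IsUnit u) (hu : ∀ z, Commute u z)
    (hD : ∀ θ ∈ Θ, ∃ β ∈ Submodule.span K (ι K '' L), ∀ z : ExteriorAlgebra K V,
      contractLeft θ (u * z) = u * (contractLeft θ z + β * z))
    (x : ExteriorAlgebra K V) :
    span L Θ (u * x) = (span L Θ x).map (LinearMap.mulLeft K u) := by
  refine le_antisymm (span_mul_le_map hΘL hu hD x) ?_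
  obtain ⟨w, rfl⟩ := hunit
  have hu' : ∀ z, Commute (↑w⁻¹ : ExteriorAlgebra K V) z := fun z => (hu z).units_inv_left
  have hc' : ∀ a b : ExteriorAlgebra K V, a * ((↑w⁻¹ : ExteriorAlgebra K V) * b) =
      (↑w⁻¹ : ExteriorAlgebra K V) * (a * b) := fun a b => by
    rw [← mul_assoc, ← (hu' a).eq, mul_assoc]
  have hD' : ∀ θ ∈ Θ, ∃ β ∈ Submodule.span K (ι K '' L), ∀ z : ExteriorAlgebra K V,
      contractLeft θ ((↑w⁻¹ : ExteriorAlgebra K V) * z) =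
        (↑w⁻¹ : ExteriorAlgebra K V) * (contractLeft θ z + β * z) := by
    intro θ hθ
    obtain ⟨β, hβ, h⟩ := hD θ hθ
    refine ⟨-β, Submodule.neg_mem _ hβ, fun z => ?_⟩
    have h1 := h (↑w⁻¹ * z)
    rw [Units.mul_inv_cancel_left] at h1
    rw [h1]
    simp only [mul_add, Units.inv_mul_cancel_left, neg_mul, mul_neg]
    rw [hc' β z]
    abel
  have h2 := span_mul_le_map hΘL hu' hD' (↑w * x)
  rw [Units.inv_mul_cancel_left] at h2
  calc (span L Θ x).map (LinearMap.mulLeft K (↑w : ExteriorAlgebra K V))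
      ≤ ((span L Θ (↑w * x)).map (LinearMap.mulLeft K (↑w⁻¹ : ExteriorAlgebra K V))).map
          (LinearMap.mulLeft K (↑w : ExteriorAlgebra K V)) := Submodule.map_mono h2
    _ = span L Θ (↑w * x) := by
        rw [← Submodule.map_comp, ← LinearMap.mulLeft_mul, Units.mul_inv, LinearMap.mulLeft_one, Submodule.map_id]

/-- **ENGINE, rank form**: under the hypotheses of `span_mul_eq_map` the contraction spans of `u ∧ x` and of `x`
have the same rank (left multiplication by the unit `u` is injective). [cite: BuchweitzFlenner2008HH, Prop. 6.4.4] -/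
theorem rank_span_mul_eq {L : Set V} {Θ : Set (Module.Dual K V)} (hΘL : ∀ θ ∈ Θ, ∀ q ∈ L, θ q = 0)
    {u : ExteriorAlgebra K V} (hunit : IsUnit u) (hu : ∀ z, Commute u z)
    (hD : ∀ θ ∈ Θ, ∃ β ∈ Submodule.span K (ι K '' L), ∀ z : ExteriorAlgebra K V,
      contractLeft θ (u * z) = u * (contractLeft θ z + β * z))
    (x : ExteriorAlgebra K V) :
    Module.rank K (span L Θ (u * x)) = Module.rank K (span L Θ x) := by
  rw [span_mul_eq_map hΘL hunit hu hD x]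
  exact (Submodule.equivMapOfInjective (LinearMap.mulLeft K u) hunit.mul_right_injective (span L Θ x)).rank_eq.symm

end Ring

/-! ### 4. The exponential of a twist class, over a field of characteristic zero -/

section Field
variable {K : Type*} [Field K] [CharZero K] {V : Type*} [AddCommGroup V] [Module K V]

omit [CharZero K] in
/-- `e^{c} = Σ_{k<N} cᵏ/k!` is central for `c ∈ span{v ∧ w}`. [cite: BourbakiAlgebre1a3, Ch. III §7] -/
theorem commute_expSum {c : ExteriorAlgebra K V}
    (hc : c ∈ Submodule.span K {z : ExteriorAlgebra K V | ∃ v w : V, z = ι K v * ι K w}) (N : ℕ)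
    (z : ExteriorAlgebra K V) :
    Commute (∑ k ∈ Finset.range N, ((k.factorial : K)⁻¹) • c ^ k) z :=
  Commute.sum_left _ _ _ fun k _ => ((commute_of_mem_span_ι_mul_ι hc z).pow_left k).smul_left _

omit [CharZero K] in
/-- `e^{c} = Σ_{k<N} cᵏ/k!` (`c ∈ span{v ∧ w}`, `c^N = 0`) is a UNIT: `1 +` a nilpotent.
[cite: BourbakiAlgebre1a3, Ch. III §7] -/
theorem isUnit_expSum {c : ExteriorAlgebra K V}
    (hc : c ∈ Submodule.span K {z : ExteriorAlgebra K V | ∃ v w : V, z = ι K v * ι K w}) {N : ℕ} (hN : c ^ N = 0) :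
    IsUnit (∑ k ∈ Finset.range N, ((k.factorial : K)⁻¹) • c ^ k) := by
  cases N with
  | zero => -- `c ^ 0 = 1 = 0`: the algebra is trivial, every element is a unit
    rw [pow_zero] at hN
    haveI := subsingleton_of_zero_eq_one hN.symm
    exact isUnit_of_subsingleton _
  | succ M =>
    rw [Finset.sum_range_succ', pow_zero, Nat.factorial_zero, Nat.cast_one, inv_one, one_smul]
    refine IsNilpotent.isUnit_add_one (Commute.isNilpotent_sum (fun k _ => ?_) fun i j _ _ => ?_)
    · exact ((isNilpotent_of_mem_span_ι_mul_ι hc).pow_succ k).smul _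
    · exact (((Commute.refl c).pow_pow (i + 1) (j + 1)).smul_left _).smul_right _

/-- **THE CONJUGATION IDENTITY** `ι_θ(e^{c} ∧ z) = e^{c} ∧ (ι_θ z + (ι_θ c) ∧ z)`, i.e. `e^{-c} ι_θ e^{c} = ι_θ + β_θ ∧`
with `β_θ = ι_θ c`, for `c ∈ span{v ∧ w}`, `c^N = 0`, `e^{c} = Σ_{k<N} cᵏ/k!` (the operator identity behind the cell's
(I2-β′); `ι_θ` a graded derivation, `c` even). [cite: BourbakiAlgebre1a3, Ch. III §11 no. 9] -/
theorem contractLeft_expSum_mul (θ : Module.Dual K V) {c : ExteriorAlgebra K V}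
    (hc : c ∈ Submodule.span K {z : ExteriorAlgebra K V | ∃ v w : V, z = ι K v * ι K w}) {N : ℕ} (hN : c ^ N = 0)
    (z : ExteriorAlgebra K V) :
    contractLeft θ ((∑ k ∈ Finset.range N, ((k.factorial : K)⁻¹) • c ^ k) * z) =
      (∑ k ∈ Finset.range N, ((k.factorial : K)⁻¹) • c ^ k) * (contractLeft θ z + contractLeft θ c * z) := by
  have hfac : ∀ k : ℕ, (((k + 1).factorial : ℕ) : K)⁻¹ * ((k + 1 : ℕ) : K) = ((k.factorial : ℕ) : K)⁻¹ := by
    intro k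
    have hk : ((k + 1 : ℕ) : K) ≠ 0 := Nat.cast_ne_zero.mpr (Nat.succ_ne_zero k)
    rw [Nat.factorial_succ, Nat.cast_mul, mul_inv, mul_comm (((k + 1 : ℕ) : K)⁻¹), mul_assoc, inv_mul_cancel₀ hk,
      mul_one]
  -- pad the sum with the vanishing term `k = N`, so that the derivative part re-indexes onto `range N`
  have hpad : (∑ k ∈ Finset.range N, ((k.factorial : K)⁻¹) • c ^ k) =
      ∑ k ∈ Finset.range (N + 1), ((k.factorial : K)⁻¹) • c ^ k := by
    rw [Finset.sum_range_succ, hN, smul_zero, add_zero]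
  have hshift : (∑ k ∈ Finset.range N, (((k + 1).factorial : K)⁻¹) • c ^ (k + 1)) + 1 =
      ∑ k ∈ Finset.range N, ((k.factorial : K)⁻¹) • c ^ k := by
    rw [hpad, Finset.sum_range_succ', pow_zero, Nat.factorial_zero, Nat.cast_one, inv_one, one_smul]
  have hterm : ∀ k ∈ Finset.range N,
      contractLeft θ ((((k + 1).factorial : K)⁻¹ • c ^ (k + 1)) * z) =
        (((k + 1).factorial : K)⁻¹ • c ^ (k + 1)) * contractLeft θ z +
          (((k.factorial : K)⁻¹) • c ^ k) * (contractLeft θ c * z) := by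
    intro k _
    rw [smul_mul_assoc, map_smul, contractLeft_pow_succ_mul θ hc k z, smul_add, smul_mul_assoc, smul_mul_assoc,
      ← Nat.cast_smul_eq_nsmul K (k + 1), smul_smul, hfac]
  conv_lhs =>
    rw [hpad, Finset.sum_mul, map_sum, Finset.sum_range_succ', pow_zero, Nat.factorial_zero, Nat.cast_one,
      inv_one, one_smul, one_mul, Finset.sum_congr rfl hterm, Finset.sum_add_distrib, ← Finset.sum_mul,
      ← Finset.sum_mul]
  rw [← hshift]
  simp only [add_mul, one_mul, mul_add]
  abel

/-- **THE CLASS-LEVEL CONJUGATION LEMMA, abstract rank form**: for `Θ` killing `L`, `c ∈ span{v ∧ q : q ∈ L}`,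
`c^N = 0`, `e^{c} = Σ_{k<N} cᵏ/k!`, the contraction spans of `x ∧ e^{c}` and of `x` have the SAME RANK —
«`r(E ⊗ M) = r(E)`» with `x = ch(E)`, `c = c₁(M)`. [cite: BuchweitzFlenner2008HH, Prop. 6.4.4] -/
theorem rank_span_mul_expSum_eq {L : Set V} {Θ : Set (Module.Dual K V)} (hΘL : ∀ θ ∈ Θ, ∀ q ∈ L, θ q = 0)
    {c : ExteriorAlgebra K V}
    (hc : c ∈ Submodule.span K {z : ExteriorAlgebra K V | ∃ v : V, ∃ q ∈ L, z = ι K v * ι K q}) {N : ℕ}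
    (hN : c ^ N = 0) (x : ExteriorAlgebra K V) :
    Module.rank K (span L Θ (x * ∑ k ∈ Finset.range N, ((k.factorial : K)⁻¹) • c ^ k)) =
      Module.rank K (span L Θ x) := by
  have hc' := span_twist_le L hc
  rw [← (commute_expSum hc' N x).eq]
  exact rank_span_mul_eq hΘL (isUnit_expSum hc' hN) (commute_expSum hc' N) (fun θ hθ =>
    ⟨contractLeft θ c, contractLeft_mem_span_image_of_mem_twist (hΘL θ hθ) hc, contractLeft_expSum_mul θ hc' hN⟩) x

/-- **Elementary twist** (simplest instance; non-vacuity witness for the hypotheses of `rank_span_mul_expSum_eq`):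
for `q ∈ L`, `v ∈ V`, `a ∈ K`, `c = a·(v ∧ q)` has `c² = 0`, `e^{c} = 1 + a·(v ∧ q)`, and the contraction spans of
`x ∧ (1 + a·(v ∧ q))` and `x` have the same rank. [cite: BourbakiAlgebre1a3, Ch. III §11 no. 9] -/
theorem rank_span_mul_one_add_smul_eq {L : Set V} {Θ : Set (Module.Dual K V)} (hΘL : ∀ θ ∈ Θ, ∀ q ∈ L, θ q = 0)
    {q : V} (hq : q ∈ L) (v : V) (a : K) (x : ExteriorAlgebra K V) :
    Module.rank K (span L Θ (x * (1 + a • (ι K v * ι K q)))) = Module.rank K (span L Θ x) := by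
  have hc : a • (ι K v * ι K q) ∈
      Submodule.span K {z : ExteriorAlgebra K V | ∃ v : V, ∃ q ∈ L, z = ι K v * ι K q} :=
    Submodule.smul_mem _ a (Submodule.subset_span ⟨v, q, hq, rfl⟩)
  have hN : (a • (ι K v * ι K q)) ^ 2 = 0 := by rw [smul_pow, ι_mul_ι_sq_eq_zero, smul_zero]
  have h := rank_span_mul_expSum_eq hΘL hc hN x
  rw [Finset.sum_range_succ, Finset.sum_range_one, pow_zero, pow_one, Nat.factorial_zero, Nat.factorial_one,
    Nat.cast_one, inv_one, one_smul, one_smul] at h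
  exact h

end Field
end ContractionSpan

/-! ### 5. Bridge: `contractionRank` on an abelian variety is twist invariant -/

/-- **(I2-β′) on the tree's REAL carriers — `r(A, κ·e^{c}) = r(A, κ)`**: for an abelian variety `A/ℂ`, a class
`c ∈ span{v ∧ q : v ∈ H¹(A(ℂ); ℂ), q ∈ H^{0,1}}` (e.g. `c₁(M)` of a line bundle, type `(1,1)`) with `c^N = 0`, and
class families with `Σ_p κ'_p = (Σ_p κ_p) · Σ_{k<N} cᵏ/k!` in `Λ H¹` (e.g. `κ = ch(E)`, `κ' = ch(E ⊗ M)`, BY VALUE),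
the polyvector contraction ranks agree — so the census-row binder «`rank Ext² ≤ lift r`» of seat p7's g = 4
theorem passes verbatim from `E₀` to `E₀ ⊗ M`. (`vectorFieldSet A` kills `hodgeZeroOneSet A` by definition;
`contractionRank_eq_rank_span` is `rfl`.) [cite: BuchweitzFlenner2008HH, Prop. 6.4.4] [cite: Fulton1998, §15.1 (i), (iii)] -/
theorem contractionRank_eq_of_totalExteriorClass_eq_mul_expSum (A : AbelianVariety ℂ)
    {κ κ' : ∀ p : ℕ, complexBetti A.X (2 * p)} {c : ExteriorAlgebra ℂ (complexBetti A.X 1)}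
    (hc : c ∈ Submodule.span ℂ {z : ExteriorAlgebra ℂ (complexBetti A.X 1) |
      ∃ v : complexBetti A.X 1, ∃ q ∈ hodgeZeroOneSet A, z = ι ℂ v * ι ℂ q})
    {N : ℕ} (hN : c ^ N = 0)
    (h : totalExteriorClass A κ' = totalExteriorClass A κ * ∑ k ∈ Finset.range N, ((k.factorial : ℂ)⁻¹) • c ^ k) :
    contractionRank A κ' = contractionRank A κ := by
  rw [contractionRank_eq_rank_span, contractionRank_eq_rank_span, h]
  exact ContractionSpan.rank_span_mul_expSum_eq (L := hodgeZeroOneSet A) (Θ := vectorFieldSet A) (fun _ hθ => hθ)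
    hc hN _

end Summit.Ventures.HSemireg

end
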